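import Summits.QuantumFields.YangMills.Theorems.BalabanUVNodesN22W1RelCentredSliceInputsLGUOfDegenerateLargeField
import Summits.QuantumFields.YangMills.Theorems.BalabanUVNodesN22W1RelCentredSliceInputsLGUOfDegenerateSmallField
import Literature.MathematicalPhysics.QuantumFieldTheory.Balaban1983to89.Node00.HistoryTermDatum214WindowDilated

/-!
# BalabanUVNodes ∕ node N22 = NE9 — THE RELATIVE-DISC CENTRED ROAD OVER THE ADMISSIBLE CLASS, MODULE J13: THE JOINT WITNESS OF THE KNIT's LOCATED ANTECEDENT — ONE term-datum
# FAMILY with ONE set of unscaled-field data obeying the UNSCALED-FIELD LAW `hlaw` on the window AND inhabiting the uniform ∕ primitive record `SliceInputsLGU` AT EVERY SLICE of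
# every step, BOTH regimes of the large-field set, on the whole configuration space (the thickening `Wt := univ`, so `hWsp` is free) — the «UNIFORM corollary + joint antecedent with
# `hlaw`» residue of ref-G g16 READ226 NOTE-1, for the knit J12-K

Cell `pub-ymgap`, HUMAN RULING D-0062 (Track A), R134 ACCELERATION re-seat `pub-ymgap-dag-n22-c` (strategy s1), generation 9, file J13.  THEOREMS ONLY; imports J13a ∕ J13b
`…SliceInputsLGUOfDegenerateLargeField ∕ SmallField` (the uniform record at ANY datum slice with free kernels and vanishing unscaled data — J12-W ∕ J12-Wb's constructions with the
inlined datum ABSTRACTED to nine `rfl`-type equations, GENERATED by `gen/build_j13.py`) and node00-def-W1 W1-11 `Node00/HistoryTermDatum214WindowDilated` (the unscaled-field law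
`W1.TermData214.UnscaledFieldLawOn`) BY NAME.  `--supports` K3⁷ `SpineGivenEndpointR13SepCoPH` (stmt-QuantumFields-20544) as a helper.

WHY.  ref-G g16 READ226 (bus 2026-08-27 20:00Z) on J10-W, NOTE-1: the A6 witnesses J10-W ∕ J10-Wb (and their J12 images J12-W ∕ J12-Wb) are POINTWISE per slice — datum and unscaled data
chosen AFTER `(Z, t, s₀)` — while the knit takes ONE datum family `𝔇 : W1.TermData214` with ONE set of unscaled data `χᵘ χᶜᵘ 𝒲 𝒪` UNIFORMLY over all slices and CONJOINS the
unscaled-field law `hlaw : 𝔇.UnscaledFieldLawOn χᵘ χᶜᵘ 𝒲 𝒪 γ` (W1-11); «the UNIFORM corollary is a one-liner the author may add — but the JOINT antecedent with `hlaw` … is NOT witnessed».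
THIS FILE witnesses exactly that joint antecedent of the knit J12-K (`ιU` ∧ `hlaw` ∧ `hWsp`), at every step `k′` at once: ONE degenerate family — NODE A's free kernels on one row bond at
every step, Cauchy radius `1`, configuration reading `0`, potentials `𝒱 ≡ 0`, and LABEL-DEPENDENT boxes `χ_{k,Y₀}(s, B) = χᶜ_{k,P}(s, B) := 1` if `P(t) = ∅`, `:= 0` otherwise (print:
the characteristic functions of a large-field term vanish near `B′ = 0`; a small-field term has no large-field function) — with the unscaled data `χᵘ = χᶜᵘ := (P(t) = ∅ ? 1 : 0)`,
`𝒲 = 𝒪 := 0`: (i) the unscaled-field law holds on EVERY window (both sides of each clause are the same constant, `𝒱 = s⁻²·0 + 0`); (ii) at every slice `(k′, Z, t, s₀ > 0)` the record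
`SliceInputsLGU (𝔇 k′) (χᵘ k′) (χᶜᵘ k′) (𝒲 k′) (𝒪 k′) c Sg Rz cs E₀ κ_E Z t univ s₀ a (1∕5) (1∕100) Mv` is inhabited — J13b at labels with `P(t) = ∅`, J13a otherwise (`1 ≤ |P(t)|`); every
torus domain is non-empty (`Z.2.1`), so no `1 ≤ |Z|` hypothesis remains.

WHAT.  ★ `locatedAntecedent_inhabited`: for every constants record `c` with `κ₁ ≥ 1` and W1-8's located τ-letters `0 < invTau c d ≤ ½` for `d ≥ 0` (both PUBLIC conjuncts of
`B13Lemma3TorusNonvacuity.numerics_nonvacuous_pos_consts` at the numerics record of record `consts`, so that module J14 can conjoin the knit's numerals), every tables `(Sg, Rz, cs)`, size letters `(E₀, κ_E)`, weight letter `a`, vertex constant `Mv > 1` and window `γ`: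
`∃ 𝔇 χᵘ χᶜᵘ 𝒲 𝒪, 𝔇.UnscaledFieldLawOn χᵘ χᶜᵘ 𝒲 𝒪 γ ∧ ∀ k′ Z t s₀, 0 < s₀ → Nonempty (SliceInputsLGU (𝔇 k′) … Z t univ s₀ a (1∕5) (1∕100) Mv)`.  Read against J12-K
`…_unscaledLawDatumLGU`: `hlaw` ✓, `ιU` ✓ (take `Wt k′ X := univ`, any `Z ⊆ X`, `t`, `s₀ ∈ ]0, γ]`, then `Classical.choice`), `hWsp` ✓ (`subset_univ`), at `a₅ = 1∕5`, `ρb = 1∕100`.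

HONEST FRAMING — what this is NOT.  An INHABITATION witness of the knit's LOCATED antecedent (datum family + unscaled data + law + per-slice records) at DEGENERATE data; it does NOT
witness the REST of J12-K's antecedent — the reading's tables `sp` with `hspk`∕`hrestr`∕`hT₀`, the capstone ∕ [KP86] ∕ aperture numerals (`hN`, `hrate`, `hsmall`, `hrenew`, `h2w`, `hMvγ`,
`hAM`, …, whose joint satisfiability with THIS witness's `a₅ = 1∕5`, `ρb = 1∕100` and the conditions on `c` is NOT claimed here — the letters are CHOSEN so that it can be: module J14), node N18 below the run (`h18`), the identification `hGn` —
so the knit as a whole stays «A6: located antecedent inhabited; full antecedent GAP-STATED».  Nothing of Bałaban's is asserted; the datum OF RECORD and its unscaled data on a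
thickening of the table of record are NODE A's ∕ N09's ∕ N10's ∕ def-W1's business; count-neutral; N22 NOT discharged; one finite four-torus programme at fixed ε — NOT infinite volume,
NOT OS on ℝ⁴, NOT a mass gap, NOT Clay.  0 `sorry`, 0 `def`, standard axioms.

References (TYPES ∕ loci only): [I] = [Balaban1987RG1] (2.9)–(2.13) pp. 266–268 (the scaling transformation and the unscaled field), §1 p. 263; [II] = [Balaban1988RG2Cluster] (2.3)
p. 12, (2.14) p. 15, (2.22) p. 16, (1.41) p. 11.
-/

noncomputable section

namespace YMDAG.N22.W1

open Set Metric Matrix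
open scoped BigOperators
open Literature.MathematicalPhysics.QuantumFieldTheory.Balaban1983to89
open Literature.MathematicalPhysics.QuantumFieldTheory.Balaban1983to89.TreeLengthTorus (TPt TDom tsys)
open Literature.MathematicalPhysics.QuantumFieldTheory.Balaban1983to89.B13Bound143 (invTau)
open Literature.MathematicalPhysics.QuantumFieldTheory.Balaban1983to89.B13TermWalkDataOneTorus (freeKernels)
open Literature.MathematicalPhysics.QuantumFieldTheory.Balaban1983to89.B5TorusCover (UT)
open Literature.MathematicalPhysics.QuantumFieldTheory.Balaban1983to89.Step (SFConsts)
open Literature.MathematicalPhysics.QuantumFieldTheory.Balaban1983to89.Node00.Sect2 (domSys domCount CPair Setting Residual)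
open Literature.MathematicalPhysics.QuantumFieldTheory.Balaban1983to89.Node00.W1

variable (c : B13.Consts) (P : Params) (𝔸 : Type*) [NormedRing 𝔸] [NormedAlgebra ℂ 𝔸] [CompleteSpace 𝔸] (M L : ℕ) [NeZero L]

open Classical in
/-- **★ THE KNIT's LOCATED ANTECEDENT IS INHABITED — ONE DATUM FAMILY, ONE SET OF UNSCALED DATA, THE UNSCALED-FIELD LAW, AND THE UNIFORM RECORD AT EVERY SLICE OF EVERY STEP, BOTH
REGIMES** (ref-G READ226 NOTE-1's residue for J12-K): for every window `γ`, `∃ 𝔇 χᵘ χᶜᵘ 𝒲 𝒪` with `𝔇.UnscaledFieldLawOn χᵘ χᶜᵘ 𝒲 𝒪 γ` (W1-11, family level) AND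
`∀ k′ Z t s₀, 0 < s₀ → Nonempty (SliceInputsLGU (𝔇 k′) (χᵘ k′) (χᶜᵘ k′) (𝒲 k′) (𝒪 k′) c Sg Rz cs E₀ κ_E Z t univ s₀ a (1∕5) (1∕100) Mv)`.  Witness: free kernels at every step, `uOf ≡ 0`,
`r = 1`, `𝒱 ≡ 0`, boxes `χ(s, B) := (P(t) = ∅ ? 1 : 0)` read by the unscaled data `χᵘ = χᶜᵘ := (P(t) = ∅ ? 1 : 0)`, `𝒲 = 𝒪 := 0`; the law is an identity of constants; the record by J13b
(`P(t) = ∅`) ∕ J13a (`1 ≤ |P(t)|`) at the nine `rfl` equations of the family.  DEGENERATE data; nothing of print's.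
[cite: Balaban1987RG1, (2.9)-(2.13) pp.266-268; Balaban1988RG2Cluster, (2.3) p.12, (2.14) p.15 and (2.22) p.16 (degenerate data; bookkeeping)] -/
theorem locatedAntecedent_inhabited (hκ₁ : 1 ≤ c.κ₁) (hinv : ∀ d : ℝ, 0 ≤ d → 0 < invTau c d ∧ invTau c d ≤ 1 / 2)
    {G : Type*} [GaugeGroup G] (Sg : Setting 𝔸 G) (Rz : Residual P 𝔸) (cs : SFConsts) (E₀ κE : ℝ)
    {Mv : ℝ} (hMv : 1 < Mv) (a γ : ℝ) :
    ∃ (𝔇 : TermData214 c P 𝔸 M L)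
      (χu χcu : (k : ℕ) → (𝔇 k).UnscaledChi) (𝒲 : (k : ℕ) → (𝔇 k).UnscaledWilson) (𝒪 : (k : ℕ) → (𝔇 k).UnscaledOlder),
      𝔇.UnscaledFieldLawOn χu χcu 𝒲 𝒪 γ ∧
      ∀ (k : ℕ) (Z : (domSys P M (k + 1)).Dom) (t : TermLabel P M k L) (s₀ : ℝ), 0 < s₀ →
        Nonempty (SliceInputsLGU (𝔇 k) (χu k) (χcu k) (𝒲 k) (𝒪 k) c Sg Rz cs E₀ κE Z t Set.univ s₀ a (1 / 5) (1 / 100) Mv) := by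
  haveI hNe : ∀ i : Fin 0, NeZero ((![] : Fin 0 → ℕ) i) := fun i => i.elim0
  let z : UT (![] : Fin 0 → ℕ) := UT.ofSite (N := (![] : Fin 0 → ℕ)) fun i => i.elim0
  -- THE DEGENERATE FAMILY, kept OPAQUE (an equation `h𝔇`): free kernels, zero reading, radius 1, LABEL-DEPENDENT constant boxes, zero potentials
  obtain ⟨𝔇, h𝔇⟩ : ∃ 𝔇 : TermData214 c P 𝔸 M L, 𝔇 = fun k =>
      { ν := 0, Nf := ![], E₃ := ℂ,
        𝒦 := fun _ _ => freeKernels c ℂ Unit Empty (fun _ => z) (fun _ => z),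
        finC₀ := fun _ _ => inferInstanceAs (Fintype Empty),
        decC₀ := fun _ _ => inferInstanceAs (DecidableEq Empty),
        uOf := fun _ _ _ => 0, r := 1,
        chiY₀ := fun _ t _ _ => if t.2 = ∅ then 1 else 0, chicP := fun _ t _ _ => if t.2 = ∅ then 1 else 0,
        𝒱 := fun _ _ _ _ _ _ _ => 0 } := ⟨_, rfl⟩
  -- THE UNSCALED DATA: the same label-dependent constant boxes (coupling-free), zero Wilson remainder, zero older-terms potential
  refine ⟨𝔇, fun k Z t _ => if t.2 = ∅ then 1 else 0, fun k Z t _ => if t.2 = ∅ then 1 else 0, fun _ _ _ _ _ _ => 0, fun _ _ _ _ _ _ _ => 0, ?_, ?_⟩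
  · -- (i) the unscaled-field law: an identity of constants at every step, slice and coupling
    intro k Z t s hs
    refine ⟨fun B => ?_, fun B => ?_, fun old φ Y B => ?_⟩
    · show (𝔇 k).chiY₀ Z t (s : ℂ) B = if t.2 = ∅ then 1 else 0
      subst h𝔇; rfl
    · show (𝔇 k).chicP Z t (s : ℂ) B = if t.2 = ∅ then 1 else 0
      subst h𝔇; rfl
    · show (𝔇 k).𝒱 Z t (s : ℂ) old φ Y B = (((s : ℝ) : ℂ) ^ 2)⁻¹ * 0 + 0
      rw [mul_zero, add_zero]; subst h𝔇; rfl
  · -- (ii) the uniform record at every slice, by cases on the large-field set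
    intro k Z t s₀ hs₀
    -- the nine `rfl` equations of the family at this slice
    have hA1 : ∀ (ψ : CPair P 𝔸) (σ : TPt P.d (domCount P M (k + 1)) → ℂ), (𝔇 k).A Z t ψ σ = 1 := by intro ψ σ; subst h𝔇; rfl
    have hG0 : ∀ (σ : TPt P.d (domCount P M (k + 1)) → ℂ) (ψ : CPair P 𝔸), ((𝔇 k).𝒦 Z t).G2 σ ((𝔇 k).uOf Z t ψ) = 0 := by intro σ ψ; subst h𝔇; rfl
    have hΓ0 : ((𝔇 k).𝒦 Z t).Γ₀ = 0 := by subst h𝔇; rfl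
    have hC1 : ((𝔇 k).𝒦 Z t).C = 1 := by subst h𝔇; rfl
    have hm : ((𝔇 k).𝒦 Z t).m = 1 := by subst h𝔇; rfl
    have hpow : ∀ x : ℝ, x ^ (𝔇 k).ν = 1 := fun x => by subst h𝔇; exact pow_zero x
    have hr1 : (𝔇 k).r = 1 := by subst h𝔇; rfl
    have hcardΛ : Fintype.card ((𝔇 k).𝒦 Z t).Λ = 1 := by subst h𝔇; exact Fintype.card_unit
    have hcardΛC : Fintype.card (((𝔇 k).𝒦 Z t).Λ ⊕ ((𝔇 k).𝒦 Z t).C₀) = 1 := by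
      have h0 : Fintype.card ((𝔇 k).𝒦 Z t).C₀ = 0 := Fintype.card_eq_zero_iff.2 ⟨fun x => by subst h𝔇; exact Empty.elim x⟩
      rw [Fintype.card_sum, hcardΛ, h0]
    have hZ : 1 ≤ (Z.1).card := Finset.card_pos.2 Z.2.1
    by_cases hP : t.2 = ∅
    · -- small field: boxes ≡ 1
      exact sliceInputsLGU_of_degenerate_smallField c P 𝔸 M k L hκ₁ hinv Sg Rz cs E₀ κE Z hZ t hP hs₀ hMv a (𝔇 k) _ _ _ _
        hA1 hG0 hΓ0 hC1 hm hpow hr1 hcardΛ hcardΛC (funext fun _ => if_pos hP) (funext fun _ => if_pos hP) (fun _ _ => rfl) (fun _ _ _ => rfl)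
    · -- large field: boxes ≡ 0
      have hP1 : 1 ≤ t.2.card := Finset.card_pos.2 (Finset.nonempty_iff_ne_empty.2 hP)
      exact sliceInputsLGU_of_degenerate_largeField c P 𝔸 M k L hκ₁ hinv Sg Rz cs E₀ κE Z hZ t hP1 hs₀ hMv a (𝔇 k) _ _ _ _
        hA1 hG0 hΓ0 hC1 hm hpow hr1 hcardΛ hcardΛC (funext fun _ => if_neg hP) (funext fun _ => if_neg hP) (fun _ _ => rfl) (fun _ _ _ => rfl)

end YMDAG.N22.W1

end
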